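import Mathlib.Analysis.SpecialFunctions.ExpDeriv
import Mathlib.Analysis.Complex.Exponential
import Mathlib.Analysis.Calculus.Deriv.Pow
import Mathlib.Analysis.Calculus.Deriv.Mul
import Mathlib.Algebra.Order.BigOperators.Group.Finset
import HarnessLib

/-!
# The calculus of the animal weights `q^a (1-q)^b`: the first two derivatives in "score" form
# (`(|O| - q·|K_S|)`, Kesten 1982 (9.34)) and the exponential TILTING identity behind the `√n`-concentration of the score
# — quant lane, METHOD = differential inequalities / regularity of percolation functions across `p_c`, seat p4 gen 30, file 1
# (tools for KESTEN'S THEOREM 9.4: `κ ∈ C²` for bond percolation on `ℤ²`)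

builds on p205010 (kernel theorem, internal audit signed; external expert review pending).
Status sentence for p205010: "θ(p_c) = 0 on ℤ^d, all d ≥ 2 — kernel-verified (Lean 4/Mathlib, standard axioms); internal
adversarial audit SIGNED 2026-08-20 04:29Z; external expert review pending."  (Nothing in THIS file uses p205010: it is pure
one-variable calculus.)

Seat `prim-quant-p4`, `--supports stmt-CriticalPhenomena-4575`; pure proofs, no definitions (`local notation3` only).

The law of the cluster animal `(S, O)` (vertex set `S`, open edges `O` among the `m = |K_S|` lattice edges touching `S`) is
`P_q(W(S,O)) = q^a (1-q)^b` with `a = |O|`, `b = m - a` (tree: `real_clusterPattern`, Grimmett (10.47), Kesten (5.24)).  Kesten's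
proof of his Theorem 9.4 (1982, p. 252) differentiates these monomials twice,
`d/dq q^a r^b = (a/q - b/r) q^a r^b`, `d²/dq² q^a r^b = ((a/q - b/r)² - a/q² - b/r²) q^a r^b` (`r = 1 - q`), and controls the
result through the SCORE `a/q - b/r = (a - q m)/(q r)`, which is of order `√m` for typical animals (his Lemma 5.1).  This file is
the division-free bookkeeping of that calculus, for natural exponents `a, b` and a real variable `q`:

* §1 `AnimalWeight.hasDerivAt_weight`, `AnimalWeight.hasDerivAt_D1` — the two derivatives, with
  `D1 = a q^{a-1} r^b - b q^a r^{b-1}` and `D2 = a(a-1) q^{a-2} r^b - 2ab q^{a-1} r^{b-1} + b(b-1) q^a r^{b-2}`;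
* §2 **`AnimalWeight.mul_D1_eq`**, **`AnimalWeight.sq_mul_D2_eq`** — the score identities
  `q r · D1 = w · (a - q m)` and `(q r)² · D2 = w · ((a - q m)² - (a r² + b q²))` (`w = q^a r^b`, `m = a + b`), hence
  **`AnimalWeight.abs_D1_le`** `|D1| ≤ w |a - qm| / (q r)` and **`AnimalWeight.abs_D2_le`** `|D2| ≤ w ((a - qm)² + m)/(q r)²`
  on `0 < q < 1`;
* §3 **`AnimalWeight.weight_mul_exp_eq`** — EXPONENTIAL TILTING: `q^a r^b · e^{t(a - qm)} = K^m · q_t^a (1 - q_t)^b` with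
  `K = q e^{t r} + r e^{-t q}` (the moment generating function of one centred Bernoulli edge) and `q_t = q e^{t r}/K ∈ [0,1]`
  (the tilted parameter): a change of the percolation parameter, exactly as in Kesten's Lemma 5.1 / Newman's transport;
  `AnimalWeight.one_le_K` (`K ≥ 1`, Jensen) and **`AnimalWeight.K_le_exp`** (`K ≤ exp(t² q r)` for `|t| ≤ 1`, from
  `e^x ≤ 1 + x + x²` on `|x| ≤ 1`) — the elementary sub-Gaussian bound that replaces Kesten's (5.23);
* §4 **`AnimalWeight.chernoff_upper`**, **`AnimalWeight.chernoff_lower`** — the CHERNOFF BOUND for a finite family of animals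
  with `m_i ≤ M`: `Σ_{i : a_i - q m_i ≥ x} c_i w_i(q) ≤ exp(-t x + t² q r M) · Σ_i c_i w_i(q_t)` (`0 ≤ t ≤ 1`, `c_i ≥ 0`), and the
  same for the lower tail with the downward tilt.  In the sequel `Σ_i c_i w_i(q_t)` is a probability (`≤ 1`), which turns this
  into the Gaussian tail `exp(-x²/(2dn))` for the score of the cluster of the origin given `|C| = n`.

Reproduction-level calculus (Kesten 1982 §5.1 Lemma 5.1, §9.3 (9.34)–(9.37), division-free); value = kernel tools for the sequel.

## References
* H. Kesten, *Percolation Theory for Mathematicians* (1982): Lemma 5.1 (5.23), (5.24)–(5.25); Thm. 9.4 and its proof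
  (9.34)–(9.37), p. 252 [Kesten1982].
* G. Grimmett, *Percolation*, 2nd ed. (1999): (10.47)–(10.48) p. 268 (the animal law), §8.7 (8.96) [GrimmettPercolation1999].
-/

noncomputable section

namespace Summit.CriticalPhenomena.PercolationContinuityZ3.Theorems

open Real Finset

namespace AnimalWeight

/-- `W[a, b, q] = q^a (1-q)^b`, the weight of an animal with `a` open and `b` closed touching edges. -/
local notation3 "W[" a ", " b ", " q "]" => (q : ℝ) ^ (a : ℕ) * (1 - q) ^ (b : ℕ)

/-- `D1[a, b, q] = a q^{a-1} (1-q)^b - b q^a (1-q)^{b-1}`, the first derivative of the weight. -/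
local notation3 "D1[" a ", " b ", " q "]" =>
  ((a : ℕ) : ℝ) * (q : ℝ) ^ ((a : ℕ) - 1) * (1 - q) ^ (b : ℕ) - ((b : ℕ) : ℝ) * q ^ (a : ℕ) * (1 - q) ^ ((b : ℕ) - 1)

/-- `D2[a, b, q] = a(a-1) q^{a-2} (1-q)^b - 2ab q^{a-1} (1-q)^{b-1} + b(b-1) q^a (1-q)^{b-2}`, the second derivative. -/
local notation3 "D2[" a ", " b ", " q "]" =>
  ((a : ℕ) : ℝ) * (((a : ℕ) - 1 : ℕ) : ℝ) * (q : ℝ) ^ ((a : ℕ) - 2) * (1 - q) ^ (b : ℕ)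
    - 2 * ((a : ℕ) : ℝ) * ((b : ℕ) : ℝ) * q ^ ((a : ℕ) - 1) * (1 - q) ^ ((b : ℕ) - 1)
    + ((b : ℕ) : ℝ) * (((b : ℕ) - 1 : ℕ) : ℝ) * q ^ (a : ℕ) * (1 - q) ^ ((b : ℕ) - 2)

/-- `KK[q, t] = q e^{t(1-q)} + (1-q) e^{-tq}`: the moment generating function `E e^{t(ω_e - q)}` of one centred edge. -/
local notation3 "KK[" q ", " t "]" => (q : ℝ) * Real.exp (t * (1 - q)) + (1 - q) * Real.exp (-(t * q))

/-- `QT[q, t] = q e^{t(1-q)} / KK[q,t]`: the tilted parameter. -/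
local notation3 "QT[" q ", " t "]" => (q : ℝ) * Real.exp (t * (1 - q)) / (KK[q, t])

/-! ### §1. The two derivatives -/

/-- `d/dq (1-q)^b = -b (1-q)^{b-1}`. [folklore] -/
theorem hasDerivAt_one_sub_pow (b : ℕ) (q : ℝ) :
    HasDerivAt (fun q : ℝ => (1 - q) ^ b) (-(((b : ℕ) : ℝ) * (1 - q) ^ (b - 1))) q := by
  have h1 : HasDerivAt (fun q : ℝ => 1 - q) (-1) q := by
    simpa using (hasDerivAt_id q).const_sub (1 : ℝ)
  have h2 : HasDerivAt (fun q : ℝ => (1 - q) ^ b) (((b : ℕ) : ℝ) * (1 - q) ^ (b - 1) * (-1)) q :=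
    (hasDerivAt_pow b (1 - q)).comp q h1
  exact h2.congr_deriv (by ring)

/-- **`d/dq (q^a (1-q)^b) = a q^{a-1}(1-q)^b - b q^a (1-q)^{b-1}`** (Kesten 1982, p. 252, first display).
[cite: Kesten1982, §9.3 proof of Thm. 9.4 (the derivative of p^n q^ℓ)] -/
theorem hasDerivAt_weight (a b : ℕ) (q : ℝ) :
    HasDerivAt (fun q : ℝ => W[a, b, q]) (D1[a, b, q]) q := by
  have h : HasDerivAt (fun q : ℝ => W[a, b, q])
      (((a : ℕ) : ℝ) * q ^ (a - 1) * (1 - q) ^ b + q ^ a * (-(((b : ℕ) : ℝ) * (1 - q) ^ (b - 1)))) q :=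
    (hasDerivAt_pow a q).mul (hasDerivAt_one_sub_pow b q)
  exact h.congr_deriv (by ring)

/-- **`d/dq D1 = D2`**: the second derivative of the weight (Kesten 1982, p. 252, second display).
[cite: Kesten1982, §9.3 proof of Thm. 9.4 (the second derivative of p^n q^ℓ)] -/
theorem hasDerivAt_D1 (a b : ℕ) (q : ℝ) :
    HasDerivAt (fun q : ℝ => D1[a, b, q]) (D2[a, b, q]) q := by
  have h1 : HasDerivAt (fun q : ℝ => ((a : ℕ) : ℝ) * q ^ (a - 1) * (1 - q) ^ b)
      (((a : ℕ) : ℝ) * ((((a - 1 : ℕ) : ℕ) : ℝ) * q ^ (a - 1 - 1)) * (1 - q) ^ b +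
        ((a : ℕ) : ℝ) * q ^ (a - 1) * (-(((b : ℕ) : ℝ) * (1 - q) ^ (b - 1)))) q :=
    ((hasDerivAt_pow (a - 1) q).const_mul ((a : ℕ) : ℝ)).mul (hasDerivAt_one_sub_pow b q)
  have h2 : HasDerivAt (fun q : ℝ => ((b : ℕ) : ℝ) * q ^ a * (1 - q) ^ (b - 1))
      (((b : ℕ) : ℝ) * (((a : ℕ) : ℝ) * q ^ (a - 1)) * (1 - q) ^ (b - 1) +
        ((b : ℕ) : ℝ) * q ^ a * (-((((b - 1 : ℕ) : ℕ) : ℝ) * (1 - q) ^ (b - 1 - 1)))) q :=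
    ((hasDerivAt_pow a q).const_mul ((b : ℕ) : ℝ)).mul (hasDerivAt_one_sub_pow (b - 1) q)
  have h := h1.sub h2
  have e1 : a - 1 - 1 = a - 2 := by omega
  have e2 : b - 1 - 1 = b - 2 := by omega
  rw [e1, e2] at h
  exact h.congr_deriv (by ring)

/-- `D2` is continuous. [folklore] -/
theorem continuous_D2 (a b : ℕ) : Continuous fun q : ℝ => D2[a, b, q] := by
  fun_prop

/-! ### §2. The score identities and the bounds -/

/-- The weight is nonnegative on `[0,1]`. [folklore] -/
theorem weight_nonneg {q : ℝ} (hq0 : 0 ≤ q) (hq1 : q ≤ 1) (a b : ℕ) : 0 ≤ W[a, b, q] := mul_nonneg (pow_nonneg hq0 _) (pow_nonneg (by linarith) _)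

/-- `q · (a q^{a-1}) = a q^a` for every natural `a` (both sides vanish for `a = 0`). [folklore] -/
theorem mul_pred_pow (a : ℕ) (q : ℝ) : q * (((a : ℕ) : ℝ) * q ^ (a - 1)) = ((a : ℕ) : ℝ) * q ^ a := by
  rcases Nat.eq_zero_or_pos a with rfl | ha
  · simp
  · obtain ⟨k, rfl⟩ : ∃ k, a = k + 1 := ⟨a - 1, by omega⟩
    have e1 : k + 1 - 1 = k := by omega
    rw [e1]
    push_cast
    ring

/-- `q² · (a (a-1) q^{a-2}) = a (a-1) q^a` for every natural `a` (both sides vanish for `a ≤ 1`). [folklore] -/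
theorem sq_mul_pred_pred_pow (a : ℕ) (q : ℝ) :
    q ^ 2 * (((a : ℕ) : ℝ) * (((a - 1 : ℕ) : ℕ) : ℝ) * q ^ (a - 2)) = ((a : ℕ) : ℝ) * ((a : ℝ) - 1) * q ^ a := by
  rcases Nat.lt_or_ge a 2 with ha | ha
  · have : a = 0 ∨ a = 1 := by omega
    rcases this with rfl | rfl <;> simp
  · obtain ⟨k, rfl⟩ : ∃ k, a = k + 2 := ⟨a - 2, by omega⟩
    have e1 : k + 2 - 1 = k + 1 := by omega
    have e2 : k + 2 - 2 = k := by omega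
    rw [e1, e2]
    push_cast
    ring

/-- **SCORE IDENTITY, first order: `q (1-q) · D1 = q^a (1-q)^b · (a - q (a + b))`** (Kesten's `(n/p - ℓ/q) p^n q^ℓ` cleared of
denominators: `a(1-q) - bq = a - q(a+b)`).  [cite: Kesten1982, §9.3 proof of Thm. 9.4 (first display)] -/
theorem mul_D1_eq (a b : ℕ) (q : ℝ) :
    q * (1 - q) * D1[a, b, q] = W[a, b, q] * ((a : ℝ) - q * ((a : ℝ) + b)) := by
  have h3 := mul_pred_pow a q
  have h4 := mul_pred_pow b (1 - q)
  linear_combination ((1 - q) * (1 - q) ^ b) * h3 - (q * q ^ a) * h4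

/-- **SCORE IDENTITY, second order: `(q(1-q))² · D2 = q^a (1-q)^b · ((a - q(a+b))² - (a (1-q)² + b q²))`**
(Kesten's `((n/p - ℓ/q)² - n/p² - ℓ/q²) p^n q^ℓ` cleared of denominators).
[cite: Kesten1982, §9.3 proof of Thm. 9.4 (second display)] -/
theorem sq_mul_D2_eq (a b : ℕ) (q : ℝ) :
    (q * (1 - q)) ^ 2 * D2[a, b, q] =
      W[a, b, q] * (((a : ℝ) - q * ((a : ℝ) + b)) ^ 2 - ((a : ℝ) * (1 - q) ^ 2 + (b : ℝ) * q ^ 2)) := by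
  have h1 := sq_mul_pred_pred_pow a q
  have h2 := sq_mul_pred_pred_pow b (1 - q)
  have h3 := mul_pred_pow a q
  have h4 := mul_pred_pow b (1 - q)
  have h34 : (q * (((a : ℕ) : ℝ) * q ^ (a - 1))) * ((1 - q) * (((b : ℕ) : ℝ) * (1 - q) ^ (b - 1))) =
      (((a : ℕ) : ℝ) * q ^ a) * (((b : ℕ) : ℝ) * (1 - q) ^ b) := by rw [h3, h4]
  linear_combination ((1 - q) ^ 2 * (1 - q) ^ b) * h1 + (q ^ 2 * q ^ a) * h2 - (2 * q * (1 - q)) * h34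

/-- **`|D1| ≤ q^a (1-q)^b |a - q(a+b)| / (q(1-q))`** on `0 < q < 1`. [cite: Kesten1982, §9.3 proof of Thm. 9.4] -/
theorem abs_D1_le {q : ℝ} (hq0 : 0 < q) (hq1 : q < 1) (a b : ℕ) :
    |D1[a, b, q]| ≤ W[a, b, q] * |(a : ℝ) - q * ((a : ℝ) + b)| / (q * (1 - q)) := by
  have hqr : 0 < q * (1 - q) := mul_pos hq0 (by linarith)
  rw [le_div_iff₀ hqr]
  have h := mul_D1_eq a b q
  have hw : 0 ≤ W[a, b, q] := weight_nonneg hq0.le hq1.le a b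
  have heq : |D1[a, b, q]| * (q * (1 - q)) = W[a, b, q] * |(a : ℝ) - q * ((a : ℝ) + b)| := by
    calc |D1[a, b, q]| * (q * (1 - q)) = |q * (1 - q) * D1[a, b, q]| := by
          rw [abs_mul, abs_of_pos hqr, mul_comm]
      _ = W[a, b, q] * |(a : ℝ) - q * ((a : ℝ) + b)| := by rw [h, abs_mul, abs_of_nonneg hw]
  exact heq.le

/-- **`|D2| ≤ q^a (1-q)^b ((a - q(a+b))² + (a + b)) / (q(1-q))²`** on `0 < q < 1` (the squared score plus the number of edges:
Kesten's bound on the second derivative of one animal term). [cite: Kesten1982, §9.3 proof of Thm. 9.4, (9.34)] -/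
theorem abs_D2_le {q : ℝ} (hq0 : 0 < q) (hq1 : q < 1) (a b : ℕ) :
    |D2[a, b, q]| ≤ W[a, b, q] * (((a : ℝ) - q * ((a : ℝ) + b)) ^ 2 + ((a : ℝ) + b)) / (q * (1 - q)) ^ 2 := by
  have hqr : 0 < q * (1 - q) := mul_pos hq0 (by linarith)
  have hqr2 : 0 < (q * (1 - q)) ^ 2 := pow_pos hqr 2
  rw [le_div_iff₀ hqr2]
  have h := sq_mul_D2_eq a b q
  have hw : 0 ≤ W[a, b, q] := weight_nonneg hq0.le hq1.le a b
  have hbr : |((a : ℝ) - q * ((a : ℝ) + b)) ^ 2 - ((a : ℝ) * (1 - q) ^ 2 + (b : ℝ) * q ^ 2)| ≤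
      ((a : ℝ) - q * ((a : ℝ) + b)) ^ 2 + ((a : ℝ) + b) := by
    have hpos1 : 0 ≤ ((a : ℝ) - q * ((a : ℝ) + b)) ^ 2 := sq_nonneg _
    have hpos2 : 0 ≤ (a : ℝ) * (1 - q) ^ 2 + (b : ℝ) * q ^ 2 := by positivity
    have hle : (a : ℝ) * (1 - q) ^ 2 + (b : ℝ) * q ^ 2 ≤ (a : ℝ) + b := by
      have h1 : (1 - q) ^ 2 ≤ 1 := by nlinarith
      have h2 : q ^ 2 ≤ 1 := by nlinarith
      nlinarith [Nat.cast_nonneg (α := ℝ) a, Nat.cast_nonneg (α := ℝ) b]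
    rw [abs_le]; constructor <;> linarith
  calc |D2[a, b, q]| * (q * (1 - q)) ^ 2 = |(q * (1 - q)) ^ 2 * D2[a, b, q]| := by
        rw [abs_mul, abs_of_pos hqr2, mul_comm]
    _ = W[a, b, q] * |((a : ℝ) - q * ((a : ℝ) + b)) ^ 2 - ((a : ℝ) * (1 - q) ^ 2 + (b : ℝ) * q ^ 2)| := by
        rw [h, abs_mul, abs_of_nonneg hw]
    _ ≤ W[a, b, q] * (((a : ℝ) - q * ((a : ℝ) + b)) ^ 2 + ((a : ℝ) + b)) := mul_le_mul_of_nonneg_left hbr hw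

/-- The score is bounded by the number of edges: `|a - q(a+b)| ≤ a + b` for `q ∈ [0,1]`. [folklore] -/
theorem abs_score_le {q : ℝ} (hq0 : 0 ≤ q) (hq1 : q ≤ 1) (a b : ℕ) :
    |(a : ℝ) - q * ((a : ℝ) + b)| ≤ (a : ℝ) + b := by
  have ha : (0 : ℝ) ≤ a := Nat.cast_nonneg a
  have hb : (0 : ℝ) ≤ b := Nat.cast_nonneg b
  rw [abs_le]; constructor <;> nlinarith

/-! ### §3. Exponential tilting -/

/-- `K ≥ 1` (`E e^{t(ω_e - q)} ≥ e^0` by Jensen; here from `1 + x ≤ e^x`), for `q ∈ [0,1]`. [folklore] -/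
theorem one_le_K {q : ℝ} (hq0 : 0 ≤ q) (hq1 : q ≤ 1) (t : ℝ) : 1 ≤ KK[q, t] := by
  have h1 : t * (1 - q) + 1 ≤ Real.exp (t * (1 - q)) := Real.add_one_le_exp _
  have h2 : -(t * q) + 1 ≤ Real.exp (-(t * q)) := Real.add_one_le_exp _
  have hq1' : 0 ≤ 1 - q := by linarith
  nlinarith [mul_le_mul_of_nonneg_left h1 hq0, mul_le_mul_of_nonneg_left h2 hq1']

/-- `K > 0`. [folklore] -/
theorem K_pos {q : ℝ} (hq0 : 0 ≤ q) (hq1 : q ≤ 1) (t : ℝ) : 0 < KK[q, t] := lt_of_lt_of_le zero_lt_one (one_le_K hq0 hq1 t)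

/-- **`K ≤ exp(t² q (1-q))` for `|t| ≤ 1`** — the elementary sub-Gaussian bound for one centred Bernoulli edge (from
`e^x ≤ 1 + x + x²` on `|x| ≤ 1`: `K ≤ 1 + t² q(1-q)`), in place of Kesten's (5.23). [cite: Kesten1982, §5.1 Lemma 5.1 (5.23)] -/
theorem K_le_exp {q t : ℝ} (hq0 : 0 ≤ q) (hq1 : q ≤ 1) (ht : |t| ≤ 1) :
    KK[q, t] ≤ Real.exp (t ^ 2 * q * (1 - q)) := by
  have hq1' : 0 ≤ 1 - q := by linarith
  have hx1 : |t * (1 - q)| ≤ 1 := by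
    rw [abs_mul, abs_of_nonneg hq1']
    calc |t| * (1 - q) ≤ 1 * 1 := mul_le_mul ht (by linarith) hq1' zero_le_one
      _ = 1 := one_mul 1
  have hx2 : |-(t * q)| ≤ 1 := by
    rw [abs_neg, abs_mul, abs_of_nonneg hq0]
    calc |t| * q ≤ 1 * 1 := mul_le_mul ht hq1 hq0 zero_le_one
      _ = 1 := one_mul 1
  have h1 := (abs_le.1 (Real.abs_exp_sub_one_sub_id_le hx1)).2
  have h2 := (abs_le.1 (Real.abs_exp_sub_one_sub_id_le hx2)).2
  have e1 : Real.exp (t * (1 - q)) ≤ 1 + t * (1 - q) + (t * (1 - q)) ^ 2 := by linarith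
  have e2 : Real.exp (-(t * q)) ≤ 1 + -(t * q) + (-(t * q)) ^ 2 := by linarith
  have hK : KK[q, t] ≤ 1 + t ^ 2 * q * (1 - q) := by
    have := add_le_add (mul_le_mul_of_nonneg_left e1 hq0) (mul_le_mul_of_nonneg_left e2 hq1')
    have hring : q * (1 + t * (1 - q) + (t * (1 - q)) ^ 2) + (1 - q) * (1 + -(t * q) + (-(t * q)) ^ 2) =
        1 + t ^ 2 * q * (1 - q) := by ring
    linarith
  calc KK[q, t] ≤ 1 + t ^ 2 * q * (1 - q) := hK
    _ ≤ Real.exp (t ^ 2 * q * (1 - q)) := by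
        have := Real.add_one_le_exp (t ^ 2 * q * (1 - q)); linarith

/-- The tilted parameter lies in `[0,1]`. [folklore] -/
theorem QT_mem {q : ℝ} (hq0 : 0 ≤ q) (hq1 : q ≤ 1) (t : ℝ) : 0 ≤ QT[q, t] ∧ QT[q, t] ≤ 1 := by
  have hK := K_pos hq0 hq1 t
  refine ⟨div_nonneg (mul_nonneg hq0 (Real.exp_pos _).le) hK.le, ?_⟩
  rw [div_le_one hK]
  have : 0 ≤ (1 - q) * Real.exp (-(t * q)) := mul_nonneg (by linarith) (Real.exp_pos _).le
  linarith

/-- `1 - q_t = (1-q) e^{-tq} / K`. [folklore] -/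
theorem one_sub_QT {q : ℝ} (hq0 : 0 ≤ q) (hq1 : q ≤ 1) (t : ℝ) :
    1 - QT[q, t] = (1 - q) * Real.exp (-(t * q)) / (KK[q, t]) := by
  have hK := (K_pos hq0 hq1 t).ne'
  rw [one_sub_div hK]
  congr 1
  ring

/-- **EXPONENTIAL TILTING: `q^a (1-q)^b · e^{t(a - q(a+b))} = K^{a+b} · q_t^a (1-q_t)^b`** — multiplying an animal weight by
`e^{t·score}` is the same as changing the percolation parameter from `q` to the tilted `q_t` and paying `K` per touching edge
(the change-of-measure step of Kesten's Lemma 5.1 / of Newman's transport, written for one animal).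
[cite: Kesten1982, §5.1 Lemma 5.1 (proof, the comparison of P_p and P_{p'})] -/
theorem weight_mul_exp_eq {q : ℝ} (hq0 : 0 ≤ q) (hq1 : q ≤ 1) (t : ℝ) (a b : ℕ) :
    W[a, b, q] * Real.exp (t * ((a : ℝ) - q * ((a : ℝ) + b))) = (KK[q, t]) ^ (a + b) * W[a, b, QT[q, t]] := by
  have hK := K_pos hq0 hq1 t
  have hsplit : Real.exp (t * ((a : ℝ) - q * ((a : ℝ) + b))) =
      Real.exp (t * (1 - q)) ^ a * Real.exp (-(t * q)) ^ b := by
    rw [← Real.exp_nat_mul, ← Real.exp_nat_mul, ← Real.exp_add]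
    congr 1; ring
  rw [hsplit, one_sub_QT hq0 hq1 t]
  generalize Real.exp (t * (1 - q)) = E1 at hK ⊢
  generalize Real.exp (-(t * q)) = E2 at hK ⊢
  have hK' : q * E1 + (1 - q) * E2 ≠ 0 := hK.ne'
  rw [div_pow, div_pow, mul_pow, mul_pow, pow_add]
  field_simp

/-! ### §4. The Chernoff bound for a finite family of animals -/

/-- **One tilted term**: if `u ≤ t · (a - q(a+b))` with `|t| ≤ 1` and `a + b ≤ M`, then
`q^a(1-q)^b ≤ exp(-u + t² q(1-q) M) · q_t^a (1-q_t)^b` (Markov's step: `1 ≤ e^{tZ - u}`, then tilting and `K^{a+b} ≤ e^{t²q(1-q)M}`).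
[cite: Kesten1982, §5.1 Lemma 5.1 (5.23)] -/
theorem weight_le_exp_mul_tilted {q t u : ℝ} (hq0 : 0 ≤ q) (hq1 : q ≤ 1) (ht : |t| ≤ 1) {a b M : ℕ} (hM : a + b ≤ M)
    (hu : u ≤ t * ((a : ℝ) - q * ((a : ℝ) + b))) :
    W[a, b, q] ≤ Real.exp (-u + t ^ 2 * q * (1 - q) * M) * W[a, b, QT[q, t]] := by
  have hw : 0 ≤ W[a, b, q] := weight_nonneg hq0 hq1 _ _
  have hQT := QT_mem hq0 hq1 t
  have hwt : 0 ≤ W[a, b, QT[q, t]] := weight_nonneg hQT.1 hQT.2 _ _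
  have h1 : W[a, b, q] ≤ Real.exp (-u) * (W[a, b, q] * Real.exp (t * ((a : ℝ) - q * ((a : ℝ) + b)))) := by
    rw [← mul_assoc, mul_comm (Real.exp _), mul_assoc, ← Real.exp_add]
    have : 1 ≤ Real.exp (-u + t * ((a : ℝ) - q * ((a : ℝ) + b))) := Real.one_le_exp (by linarith)
    nlinarith
  rw [weight_mul_exp_eq hq0 hq1 t] at h1
  have h2 : (KK[q, t]) ^ (a + b) ≤ Real.exp (t ^ 2 * q * (1 - q) * M) := by
    calc (KK[q, t]) ^ (a + b) ≤ (KK[q, t]) ^ M := pow_le_pow_right₀ (one_le_K hq0 hq1 t) hM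
      _ ≤ (Real.exp (t ^ 2 * q * (1 - q))) ^ M := pow_le_pow_left₀ (by linarith [one_le_K hq0 hq1 t]) (K_le_exp hq0 hq1 ht) M
      _ = Real.exp (t ^ 2 * q * (1 - q) * M) := by rw [← Real.exp_nat_mul]; ring_nf
  calc W[a, b, q] ≤ Real.exp (-u) * ((KK[q, t]) ^ (a + b) * W[a, b, QT[q, t]]) := h1
    _ ≤ Real.exp (-u) * (Real.exp (t ^ 2 * q * (1 - q) * M) * W[a, b, QT[q, t]]) := by gcongr
    _ = Real.exp (-u + t ^ 2 * q * (1 - q) * M) * W[a, b, QT[q, t]] := by rw [Real.exp_add]; ring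

variable {ι : Type*}

/-- **CHERNOFF BOUND, upper tail.**  For a finite family of animals `i` with `a_i` open and `b_i` closed touching edges,
`a_i + b_i ≤ M`, and nonnegative coefficients `c_i`: for `0 ≤ t ≤ 1` and every `x`,
`Σ_{i : x ≤ a_i - q(a_i + b_i)} c_i w_i(q) ≤ exp(-t x + t² q(1-q) M) · Σ_i c_i w_i(q_t)`.
[cite: Kesten1982, §5.1 Lemma 5.1 (5.23)] -/
theorem chernoff_upper [DecidableEq ι] (s : Finset ι) (a b : ι → ℕ) (c : ι → ℝ) (hc : ∀ i ∈ s, 0 ≤ c i)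
    {M : ℕ} (hM : ∀ i ∈ s, a i + b i ≤ M) {q t : ℝ} (hq0 : 0 ≤ q) (hq1 : q ≤ 1) (ht0 : 0 ≤ t) (ht1 : t ≤ 1) (x : ℝ) :
    ∑ i ∈ s.filter (fun i => x ≤ (a i : ℝ) - q * ((a i : ℝ) + b i)), c i * W[a i, b i, q] ≤
      Real.exp (-(t * x) + t ^ 2 * q * (1 - q) * M) * ∑ i ∈ s, c i * W[a i, b i, QT[q, t]] := by
  have hQT := QT_mem hq0 hq1 t
  have ht : |t| ≤ 1 := by rw [abs_of_nonneg ht0]; exact ht1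
  calc ∑ i ∈ s.filter (fun i => x ≤ (a i : ℝ) - q * ((a i : ℝ) + b i)), c i * W[a i, b i, q]
      ≤ ∑ i ∈ s.filter (fun i => x ≤ (a i : ℝ) - q * ((a i : ℝ) + b i)),
          c i * (Real.exp (-(t * x) + t ^ 2 * q * (1 - q) * M) * W[a i, b i, QT[q, t]]) := by
        refine Finset.sum_le_sum fun i hi => ?_
        rw [Finset.mem_filter] at hi
        refine mul_le_mul_of_nonneg_left ?_ (hc i hi.1)
        exact weight_le_exp_mul_tilted hq0 hq1 ht (hM i hi.1) (mul_le_mul_of_nonneg_left hi.2 ht0)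
    _ ≤ ∑ i ∈ s, c i * (Real.exp (-(t * x) + t ^ 2 * q * (1 - q) * M) * W[a i, b i, QT[q, t]]) := by
        refine Finset.sum_le_sum_of_subset_of_nonneg (Finset.filter_subset _ _) fun i hi _ => ?_
        exact mul_nonneg (hc i hi) (mul_nonneg (Real.exp_pos _).le (weight_nonneg hQT.1 hQT.2 _ _))
    _ = Real.exp (-(t * x) + t ^ 2 * q * (1 - q) * M) * ∑ i ∈ s, c i * W[a i, b i, QT[q, t]] := by
        rw [Finset.mul_sum]; refine Finset.sum_congr rfl fun i _ => ?_; ring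

/-- **CHERNOFF BOUND, lower tail**: for `0 ≤ t ≤ 1` and every `x`,
`Σ_{i : a_i - q(a_i+b_i) ≤ -x} c_i w_i(q) ≤ exp(-t x + t² q(1-q) M) · Σ_i c_i w_i(q_{-t})` (tilting downwards).
[cite: Kesten1982, §5.1 Lemma 5.1 (5.23)] -/
theorem chernoff_lower [DecidableEq ι] (s : Finset ι) (a b : ι → ℕ) (c : ι → ℝ) (hc : ∀ i ∈ s, 0 ≤ c i)
    {M : ℕ} (hM : ∀ i ∈ s, a i + b i ≤ M) {q t : ℝ} (hq0 : 0 ≤ q) (hq1 : q ≤ 1) (ht0 : 0 ≤ t) (ht1 : t ≤ 1) (x : ℝ) :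
    ∑ i ∈ s.filter (fun i => (a i : ℝ) - q * ((a i : ℝ) + b i) ≤ -x), c i * W[a i, b i, q] ≤
      Real.exp (-(t * x) + t ^ 2 * q * (1 - q) * M) * ∑ i ∈ s, c i * W[a i, b i, QT[q, -t]] := by
  have hQT := QT_mem hq0 hq1 (-t)
  have ht : |(-t)| ≤ 1 := by rw [abs_neg, abs_of_nonneg ht0]; exact ht1
  have hsq : (-t) ^ 2 = t ^ 2 := by ring
  calc ∑ i ∈ s.filter (fun i => (a i : ℝ) - q * ((a i : ℝ) + b i) ≤ -x), c i * W[a i, b i, q]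
      ≤ ∑ i ∈ s.filter (fun i => (a i : ℝ) - q * ((a i : ℝ) + b i) ≤ -x),
          c i * (Real.exp (-(t * x) + t ^ 2 * q * (1 - q) * M) * W[a i, b i, QT[q, -t]]) := by
        refine Finset.sum_le_sum fun i hi => ?_
        rw [Finset.mem_filter] at hi
        refine mul_le_mul_of_nonneg_left ?_ (hc i hi.1)
        have h := weight_le_exp_mul_tilted (u := t * x) hq0 hq1 ht (hM i hi.1) (by nlinarith [hi.2])
        rwa [hsq] at h
    _ ≤ ∑ i ∈ s, c i * (Real.exp (-(t * x) + t ^ 2 * q * (1 - q) * M) * W[a i, b i, QT[q, -t]]) := by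
        refine Finset.sum_le_sum_of_subset_of_nonneg (Finset.filter_subset _ _) fun i hi _ => ?_
        exact mul_nonneg (hc i hi) (mul_nonneg (Real.exp_pos _).le (weight_nonneg hQT.1 hQT.2 _ _))
    _ = Real.exp (-(t * x) + t ^ 2 * q * (1 - q) * M) * ∑ i ∈ s, c i * W[a i, b i, QT[q, -t]] := by
        rw [Finset.mul_sum]; refine Finset.sum_congr rfl fun i _ => ?_; ring

/-- **The two tails together**: `Σ_{i : |a_i - q(a_i+b_i)| ≥ x} c_i w_i(q)` is at most the sum of the two Chernoff bounds.
[cite: Kesten1982, §5.1 Lemma 5.1 (5.23)] -/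
theorem chernoff_abs [DecidableEq ι] (s : Finset ι) (a b : ι → ℕ) (c : ι → ℝ) (hc : ∀ i ∈ s, 0 ≤ c i)
    {M : ℕ} (hM : ∀ i ∈ s, a i + b i ≤ M) {q t : ℝ} (hq0 : 0 ≤ q) (hq1 : q ≤ 1) (ht0 : 0 ≤ t) (ht1 : t ≤ 1) (x : ℝ) :
    ∑ i ∈ s.filter (fun i => x ≤ |(a i : ℝ) - q * ((a i : ℝ) + b i)|), c i * W[a i, b i, q] ≤
      Real.exp (-(t * x) + t ^ 2 * q * (1 - q) * M) *
        (∑ i ∈ s, c i * W[a i, b i, QT[q, t]] + ∑ i ∈ s, c i * W[a i, b i, QT[q, -t]]) := by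
  have hU := chernoff_upper s a b c hc hM hq0 hq1 ht0 ht1 x
  have hL := chernoff_lower s a b c hc hM hq0 hq1 ht0 ht1 x
  have hnn' : ∀ i ∈ s, 0 ≤ c i * W[a i, b i, q] := fun i hi => mul_nonneg (hc i hi) (weight_nonneg hq0 hq1 _ _)
  -- split the two-sided tail into the upper and the lower tail
  set T := s.filter (fun i => x ≤ |(a i : ℝ) - q * ((a i : ℝ) + b i)|) with hT
  have hsplit := Finset.sum_filter_add_sum_filter_not T (fun i => x ≤ (a i : ℝ) - q * ((a i : ℝ) + b i))
    (fun i => c i * W[a i, b i, q])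
  have hA : ∑ i ∈ T.filter (fun i => x ≤ (a i : ℝ) - q * ((a i : ℝ) + b i)), c i * W[a i, b i, q] ≤
      ∑ i ∈ s.filter (fun i => x ≤ (a i : ℝ) - q * ((a i : ℝ) + b i)), c i * W[a i, b i, q] := by
    refine Finset.sum_le_sum_of_subset_of_nonneg ?_ fun i hi _ => hnn' i (Finset.mem_filter.1 hi).1
    intro i hi
    rw [Finset.mem_filter] at hi ⊢
    exact ⟨(Finset.mem_filter.1 hi.1).1, hi.2⟩
  have hB : ∑ i ∈ T.filter (fun i => ¬ (x ≤ (a i : ℝ) - q * ((a i : ℝ) + b i))), c i * W[a i, b i, q] ≤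
      ∑ i ∈ s.filter (fun i => (a i : ℝ) - q * ((a i : ℝ) + b i) ≤ -x), c i * W[a i, b i, q] := by
    refine Finset.sum_le_sum_of_subset_of_nonneg ?_ fun i hi _ => hnn' i (Finset.mem_filter.1 hi).1
    intro i hi
    rw [Finset.mem_filter] at hi ⊢
    have hi1 := Finset.mem_filter.1 hi.1
    refine ⟨hi1.1, ?_⟩
    rcases le_abs'.1 hi1.2 with h | h
    · linarith
    · exact absurd h hi.2
  calc ∑ i ∈ T, c i * W[a i, b i, q]
      = ∑ i ∈ T.filter (fun i => x ≤ (a i : ℝ) - q * ((a i : ℝ) + b i)), c i * W[a i, b i, q] +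
          ∑ i ∈ T.filter (fun i => ¬ (x ≤ (a i : ℝ) - q * ((a i : ℝ) + b i))), c i * W[a i, b i, q] := hsplit.symm
    _ ≤ ∑ i ∈ s.filter (fun i => x ≤ (a i : ℝ) - q * ((a i : ℝ) + b i)), c i * W[a i, b i, q] +
          ∑ i ∈ s.filter (fun i => (a i : ℝ) - q * ((a i : ℝ) + b i) ≤ -x), c i * W[a i, b i, q] := add_le_add hA hB
    _ ≤ _ := by rw [mul_add]; exact add_le_add hU hL

end AnimalWeight

end Summit.CriticalPhenomena.PercolationContinuityZ3.Theorems
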